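import Summits.QuantumAdvantage.QuantumAdvantage.Theorems.PebbleDialA

/-! # PebbleDialB — part 2/3 (mechanical split for landing of `PebbleDial`; content verbatim; scopes re-opened with their variables) -/

set_option linter.dupNamespace false

namespace Summit.QuantumAdvantage.QuantumAdvantage.Theorems.PebbleDial
open Finset
open Literature.Computability.Complexity
open Literature.Computability.QuantumComplexity
open Summit.QuantumAdvantage.QuantumAdvantage.Theses.AnfPresentation
open Summit.QuantumAdvantage.QuantumAdvantage.Theorems.HintDial (eval_bit bit_injective rungA_of_anfResidual)
open CubicForm (bit)
variable {n : ℕ}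

/-- [dictionary] `SymTC`: the languages over `{0,1}` that AGREE ON INSTANCE CODES with some polynomial-size
symmetric threshold family (behaviour off the codes is unconstrained — the promise lives on codes). -/
def SymTC : Set (Language Bool) :=
  {L | ∃ C, IsSymTCFamily C ∧ ∀ I : CubicANFPair, I.encode ∈ L ↔ accepts C I = true}

/-- ★ [law] A symmetric threshold family decides an isomorphism-invariant class of ANF structures
(tree `IsVarSymmetric.eval_comp_eq` + `isSymmetric_of_mem_tcBasis`; Anderson–Dawar 2017, §2.2). -/
theorem accepts_permPair {C : (n : ℕ) → Circuit (AnfIdx n)} (hC : IsSymTCFamily C) (I : CubicANFPair)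
    (σ : Equiv.Perm (Fin I.n)) : accepts C (permPair I σ) = accepts C I := by
  show (C I.n).eval (bits (permPair I σ)) = (C I.n).eval (bits I)
  rw [bits_permPair]
  exact (hC.1 I.n).1.eval_comp_eq (fun g hg => isSymmetric_of_mem_tcBasis ((hC.1 I.n).2 g hg))
    (permIdx_mem_diag σ) _

/-- The language CUT OUT by a family: exactly the codes it accepts.  It lies in `SymTC`. -/
def langOf (C : (n : ℕ) → Circuit (AnfIdx n)) : Language Bool :=
  {w | ∃ I : CubicANFPair, I.encode = w ∧ accepts C I = true}

/-- PebbleDialB helper `mem_langOf_iff` (decomp-qadv land package; see the module docstring). -/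
theorem mem_langOf_iff (C : (n : ℕ) → Circuit (AnfIdx n)) (I : CubicANFPair) :
    I.encode ∈ langOf C ↔ accepts C I = true := by
  constructor
  · rintro ⟨J, hJ, hacc⟩
    rw [← CubicANFPair.encode_injective hJ]; exact hacc
  · exact fun h => ⟨I, rfl, h⟩

/-- PebbleDialB helper `langOf_mem_symTC` (decomp-qadv land package; see the module docstring). -/
theorem langOf_mem_symTC {C : (n : ℕ) → Circuit (AnfIdx n)} (hC : IsSymTCFamily C) : langOf C ∈ SymTC :=
  ⟨C, hC, mem_langOf_iff C⟩

/-! ## §3 The pieces, the one certified translation, the split, and `closes` -/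

/-- [crux · WEAKER · UNDECIDED · ATTACKABLE] `SymRung` — THE SYMMETRIC RUNG: the signed exact cubic ANF slice is not
decided by any polynomial-time language all of whose slices are polynomial-size symmetric threshold circuits on the
ANF structure.  NECESSARY for `X` (`symRung_of_anfResidual`).  STRICTLY WEAKER in content: the class
`SymTC ∩ P` misses Gaussian elimination over `𝔽₂` (solvability of linear systems is not in FPC —
Atserias–Bulatov–Dawar 2009; Dawar 2024 p. 4), while `P` and `BPP` contain it.  ATTACKABLE with unconditional
technology: support theorem ⟹ `C^k`-invariance ⟹ it suffices to build opposite-sign exact pairs that are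
`C^k`-equivalent for every `k` (`§4`, `symRungNU_of_foolingPairs`).  WHY IT MIGHT CLOSE CHEAPLY: on instances
whose structure colour refinement individualises, symmetric polynomial time = polynomial time (Immerman–Vardi on
the definable order), so all the rung's content sits on non-individualisable `(F,G)` — if CFI-style fooling pairs
exist inside the exact slice the rung becomes a THEOREM and `X`'s residual is `SymLift`. -/
def SymRung : Prop := SignedExactCubicSliceANF ∉ promiseLift (SymTC ∩ Classes.P)

/-- [line target · STRONGER than `SymRung` · T-orthogonal] the NON-UNIFORM symmetric rung: no polynomial-size
symmetric threshold family at all answers the sign (no `P` condition).  By Atserias–Dawar–Ochremiak 2021 (cited in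
Dawar 2024, p. 5) non-uniform polynomial-size symmetric threshold families decide exactly the classes of bounded
counting width, so this is «the sign query on exact cubic ANF structures has unbounded Weisfeiler–Leman dimension». -/
def SymRungNU : Prop := SignedExactCubicSliceANF ∉ promiseLift SymTC

/-- [residual · WEAKER than `LiftA` · IDEA-NEEDED · declared RESIDUAL] `SymLift`: from the `AC⁰[⊕] ∩ P` rung AND
the symmetric rung to `promise-BPP` hardness.  A bare conditional (shape A): it records exactly what the two class
dials leave of `X`, namely symmetrisation/derandomisation of a `BPP` decider on the non-individualisable core. -/
def SymLift : Prop := RungA → SymRung → AnfResidual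

/-- A family ANSWERS THE SIGN if it accepts every even-arity instance of value `1` and rejects every even-arity
instance of value `-1` (nothing asked off the promise). -/
def SolvesSign (C : (n : ℕ) → Circuit (AnfIdx n)) : Prop :=
  ∀ I : CubicANFPair, Even I.n → (I.value = 1 → accepts C I = true) ∧ (I.value = -1 → accepts C I = false)

/-- ★★ [EQUIV — the lens's ONE certified translation, non-uniform form] the `promiseLift` statement IS the
symmetric-circuit lower bound: `SymRungNU ↔` no polynomial-size symmetric threshold family answers the sign. -/
theorem symRungNU_iff : SymRungNU ↔ ∀ C, IsSymTCFamily C → ¬ SolvesSign C := by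
  constructor
  · intro h C hC hS
    refine h ⟨langOf C, langOf_mem_symTC hC, fun w hw => ?_, fun w hw => ?_⟩
    · obtain ⟨I, ⟨he, hv⟩, rfl⟩ := hw
      exact (mem_langOf_iff C I).2 (((hS I he).1) hv)
    · obtain ⟨I, ⟨he, hv⟩, rfl⟩ := hw
      exact fun hL => Bool.false_ne_true ((((hS I he).2) hv).symm.trans ((mem_langOf_iff C I).1 hL))
  · rintro H ⟨L, ⟨C, hC, hagree⟩, hyes, hno⟩
    refine H C hC fun I he => ⟨fun hv => ?_, fun hv => ?_⟩
    · exact (hagree I).1 (hyes ((CubicANFPair.encode_mem_yes_iff I).2 ⟨he, hv⟩))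
    · exact Bool.eq_false_iff.2 fun hacc => (hno ((CubicANFPair.encode_mem_no_iff I).2 ⟨he, hv⟩)) ((hagree I).2 hacc)

/-- ★★ [EQUIV — uniform form] `SymRung ↔` no polynomial-size symmetric threshold family that agrees on codes with
SOME polynomial-time language answers the sign. -/
theorem symRung_iff : SymRung ↔ ∀ C, IsSymTCFamily C →
    (∃ L ∈ Classes.P, ∀ I : CubicANFPair, I.encode ∈ L ↔ accepts C I = true) → ¬ SolvesSign C := by
  constructor
  · rintro h C hC ⟨L, hLP, hagree⟩ hS
    refine h ⟨L, ⟨⟨C, hC, hagree⟩, hLP⟩, fun w hw => ?_, fun w hw => ?_⟩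
    · obtain ⟨I, ⟨he, hv⟩, rfl⟩ := hw
      exact (hagree I).2 (((hS I he).1) hv)
    · obtain ⟨I, ⟨he, hv⟩, rfl⟩ := hw
      exact fun hL => Bool.false_ne_true ((((hS I he).2) hv).symm.trans ((hagree I).1 hL))
  · rintro H ⟨L, ⟨⟨C, hC, hagree⟩, hLP⟩, hyes, hno⟩
    refine H C hC ⟨L, hLP, hagree⟩ fun I he => ⟨fun hv => ?_, fun hv => ?_⟩
    · exact (hagree I).1 (hyes ((CubicANFPair.encode_mem_yes_iff I).2 ⟨he, hv⟩))
    · exact Bool.eq_false_iff.2 fun hacc => (hno ((CubicANFPair.encode_mem_no_iff I).2 ⟨he, hv⟩)) ((hagree I).2 hacc)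

/-- [law · necessity] `X → SymRung` (`promiseLift (SymTC ∩ P) ⊆ PromiseP ⊆ PromiseBPP'`). -/
theorem symRung_of_anfResidual : AnfResidual → SymRung :=
  fun hres h => hres (PromiseP_subset_PromiseBPP' (promiseLift_mono Set.inter_subset_right h))

/-- [law] the non-uniform rung implies the uniform one. -/
theorem symRung_of_symRungNU : SymRungNU → SymRung :=
  fun h hm => h (promiseLift_mono Set.inter_subset_left hm)

/-- [law · necessity] `LiftA → SymLift` and `X → SymLift` (the residual is below both). -/
theorem symLift_of_liftA : LiftA → SymLift := fun ℓ r _ => ℓ r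

/-- PebbleDialB helper `symLift_of_anfResidual` (decomp-qadv land package; see the module docstring). -/
theorem symLift_of_anfResidual : AnfResidual → SymLift := fun x _ _ => x

/-- [law · sufficiency] the two new pieces give back the parent residual `LiftA`. -/
theorem liftA_of_symRung_symLift : SymRung → SymLift → LiftA := fun u ℓ r => ℓ r u

/-- ★ [split of the parent residual] `LiftA ↔ (RungA → SymRung) ∧ SymLift`. -/
theorem liftA_iff : LiftA ↔ (RungA → SymRung) ∧ SymLift :=
  ⟨fun ℓ => ⟨fun r => symRung_of_anfResidual (ℓ r), symLift_of_liftA ℓ⟩, fun h r => h.2 r (h.1 r)⟩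

/-- ★★ [exact split of the target] `X ↔ RungA ∧ SymRung ∧ SymLift` — every piece NECESSARY, jointly SUFFICIENT. -/
theorem anfResidual_iff : AnfResidual ↔ RungA ∧ SymRung ∧ SymLift :=
  ⟨fun x => ⟨rungA_of_anfResidual x, symRung_of_anfResidual x, symLift_of_anfResidual x⟩,
    fun h => h.2.2 h.1 h.2.1⟩

/-- [assembly] the node's assembly Prop (pieces → summit), for the record. -/
def Assembly : Prop :=
  NearExactIsExact → SignedExactSliceIsLift → RungA → SymRung → SymLift → AnfEquiv → _root_.QuantumAdvantage

/-- ★★★ `closes` — THE ROOT BY NAME: the parent route's side items, its blocker `RungA`, the symmetric rung and the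
new residual prove `QuantumAdvantage` (through `AnfPresentation.closes`, with `LiftA := liftA_of_symRung_symLift`). -/
theorem closes (h₁ : NearExactIsExact) (h₂ : SignedExactSliceIsLift) (p₁ : RungA) (u : SymRung) (ℓ : SymLift)
    (hE : AnfEquiv) : _root_.QuantumAdvantage :=
  Summit.QuantumAdvantage.QuantumAdvantage.Theses.AnfPresentation.closes h₁ h₂ p₁ (liftA_of_symRung_symLift u ℓ) hE

/-- PebbleDialB helper `assembly` (decomp-qadv land package; see the module docstring). -/
theorem assembly : Assembly := closes

/-! ## §4 The line beneath `SymRung`: bijective pebble games on ANF structures, fooling pairs, supports -/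

/-- [dictionary] A PARTIAL ISOMORPHISM between the ANF structures `𝔄(F,G)` and `𝔄(F',G')` on `[n]`: a set of
pebble pairs that is a partial bijection and preserves both ternary tables on pebbled triples
(Hella's game positions; cf. tree `FiniteModelTheory.IsPartialIso` for graphs). -/
structure IsPartialIsoANF (F G F' G' : CubicForm n) (p : Set (Fin n × Fin n)) : Prop where
  eq_iff : ∀ ⦃a⦄, a ∈ p → ∀ ⦃b⦄, b ∈ p → (a.1 = b.1 ↔ a.2 = b.2)
  cubeF : ∀ ⦃a⦄, a ∈ p → ∀ ⦃b⦄, b ∈ p → ∀ ⦃c⦄, c ∈ p → F.cube a.1 b.1 c.1 = F'.cube a.2 b.2 c.2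
  cubeG : ∀ ⦃a⦄, a ∈ p → ∀ ⦃b⦄, b ∈ p → ∀ ⦃c⦄, c ∈ p → G.cube a.1 b.1 c.1 = G'.cube a.2 b.2 c.2

/-- [dictionary] A winning strategy for Duplicator in the BIJECTIVE `k`-PEBBLE GAME on two ANF structures
(verbatim the tree's `FiniteModelTheory.BijPebbleStrategy`, with `IsPartialIsoANF` for `IsPartialIso`). -/
structure BijPebbleStrategyANF (k : ℕ) (F G F' G' : CubicForm n) where
  carrier : Set (Set (Fin n × Fin n))
  empty_mem : ∅ ∈ carrier
  ncard_le_of_mem : ∀ ⦃p⦄, p ∈ carrier → p.ncard ≤ k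
  isPartialIso_of_mem : ∀ ⦃p⦄, p ∈ carrier → IsPartialIsoANF F G F' G' p
  mem_of_subset : ∀ ⦃p⦄, p ∈ carrier → ∀ ⦃q⦄, q ⊆ p → q ∈ carrier
  forth : ∀ ⦃p⦄, p ∈ carrier → p.ncard < k → ∃ f : Fin n ≃ Fin n, ∀ a : Fin n, insert (a, f a) p ∈ carrier

/-- [dictionary] `𝔄(F,G) ≡_{C^k} 𝔄(F',G')`: equal constants and a Duplicator strategy with `k` pebble pairs
(Hella 1996 / Grohe–Otto 2015 Thm 2.2: equivalence in `k`-variable counting logic; `(k-1)`-dimensional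
Weisfeiler–Leman indistinguishability of the two structures). -/
def CkEquivANF (k : ℕ) (F G F' G' : CubicForm n) : Prop :=
  (F.const = F'.const ∧ G.const = G'.const) ∧ Nonempty (BijPebbleStrategyANF k F G F' G')

/-- Duplicator's strategy along the isomorphism `σ : 𝔄(σ·F, σ·G) ≅ 𝔄(F, G)`: all positions inside the graph
of `σ` with at most `k` pebble pairs. -/
def isoStrategy (k : ℕ) (σ : Equiv.Perm (Fin n)) (F G : CubicForm n) :
    BijPebbleStrategyANF k (permForm σ F) (permForm σ G) F G where
  carrier := setOf fun p => p.ncard ≤ k ∧ ∀ a ∈ p, a.2 = σ a.1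
  empty_mem := by simp
  ncard_le_of_mem := fun _ hp => hp.1
  isPartialIso_of_mem := fun p hp => by
    refine ⟨fun a ha b hb => ?_, fun a ha b hb c hc => ?_, fun a ha b hb c hc => ?_⟩
    · rw [hp.2 a ha, hp.2 b hb]; exact σ.injective.eq_iff.symm
    · rw [hp.2 a ha, hp.2 b hb, hp.2 c hc]; rfl
    · rw [hp.2 a ha, hp.2 b hb, hp.2 c hc]; rfl
  mem_of_subset := fun p hp q hq =>
    ⟨(Set.ncard_le_ncard hq (Set.toFinite p)).trans hp.1, fun a ha => hp.2 a (hq ha)⟩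
  forth := fun p hp hlt => ⟨σ, fun a => ⟨(Set.ncard_insert_le _ _).trans (Nat.succ_le_of_lt hlt), by
    rintro b (rfl | hb)
    · rfl
    · exact hp.2 b hb⟩⟩

/-- Isomorphic structures are `C^k`-equivalent for every `k` (Duplicator plays along the isomorphism). -/
theorem ckEquivANF_permForm (k : ℕ) (σ : Equiv.Perm (Fin n)) (F G : CubicForm n) :
    CkEquivANF k (permForm σ F) (permForm σ G) F G :=
  And.intro ⟨rfl, rfl⟩ ⟨isoStrategy k σ F G⟩

/-- Restricting a `k`-pebble strategy to positions with at most `j ≤ k` pairs. -/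
def BijPebbleStrategyANF.restrict {j k : ℕ} {F G F' G' : CubicForm n} (S : BijPebbleStrategyANF k F G F' G')
    (hjk : j ≤ k) : BijPebbleStrategyANF j F G F' G' where
  carrier := setOf fun p => p ∈ S.carrier ∧ p.ncard ≤ j
  empty_mem := ⟨S.empty_mem, by simp⟩
  ncard_le_of_mem := fun _ hp => hp.2
  isPartialIso_of_mem := fun _ hp => S.isPartialIso_of_mem hp.1
  mem_of_subset := fun p hp q hq =>
    ⟨S.mem_of_subset hp.1 hq, (Set.ncard_le_ncard hq (Set.toFinite p)).trans hp.2⟩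
  forth := fun p hp hlt => by
    obtain ⟨f, hf⟩ := S.forth hp.1 (lt_of_lt_of_le hlt hjk)
    exact ⟨f, fun a => ⟨hf a, (Set.ncard_insert_le _ _).trans (Nat.succ_le_of_lt hlt)⟩⟩

/-- PebbleDialB helper `CkEquivANF.mono` (decomp-qadv land package; see the module docstring). -/
theorem CkEquivANF.mono {j k : ℕ} {F G F' G' : CubicForm n} (h : CkEquivANF k F G F' G') (hjk : j ≤ k) :
    CkEquivANF j F G F' G' :=
  And.intro h.1 (h.2.elim fun S => ⟨S.restrict hjk⟩)

/-- [line · T-free · ATTACKABLE · UNDECIDED] `FoolingPairs k`: for infinitely many (even) arities there are two exact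
cubic ANF instances of OPPOSITE sign that Duplicator cannot distinguish with `k` pebble pairs.  A purely
combinatorial statement about cubic forms over `𝔽₂` (no complexity class occurs); the Cai–Fürer–Immerman
template (twisted vs untwisted gadgets over a low-treewidth-free base) is the intended construction, the bent /
Maiorana–McFarland structure of exact pairs (tree `HintDial` §1–2) the intended host. -/
def FoolingPairs (k : ℕ) : Prop :=
  ∀ n₀ : ℕ, ∃ n, n₀ ≤ n ∧ Even n ∧ ∃ F G F' G' : CubicForm n,
    CkEquivANF k F G F' G' ∧ (⟨n, F, G⟩ : CubicANFPair).value = 1 ∧ (⟨n, F', G'⟩ : CubicANFPair).value = -1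

/-- [line hypothesis · NAMED, print-backed, not proved here] `SupportTheoremANF`: every polynomial-size symmetric
threshold family on ANF structures is, from some arity on, invariant under `≡_{C^k}` for a constant `k`
(Anderson–Dawar 2017, Support Theorem: polynomial-size symmetric families have supports of CONSTANT size,
after rigidification; Dawar–Wilsenach 2022 [corpus:paper:url-ef02fae885a6 p.11, Thm 14]: if Duplicator wins the
`2k`-pebble bijection game on two inputs then every symmetric circuit with supports of size `≤ k` gives them the same
value — both stated for arbitrary relational / indexed-set inputs; tree twin of the combination for graphs:
`FiniteModelTheory.AndersonDawar2016_supports_countingWidth`). -/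
def SupportTheoremANF : Prop :=
  ∀ C : (n : ℕ) → Circuit (AnfIdx n), IsSymTCFamily C → ∃ k n₀ : ℕ, ∀ n, n₀ ≤ n →
    ∀ F G F' G' : CubicForm n, CkEquivANF k F G F' G' → (C n).eval (bitsFG F G) = (C n).eval (bitsFG F' G')

/-- ★★ [line law, PROVED] SUPPORTS + FOOLING PAIRS ⟹ THE NON-UNIFORM SYMMETRIC RUNG: a symmetric family answering
the sign would be `C^k`-invariant from some arity on, and a `k`-fooling pair of larger even arity makes it accept an
instance of value `-1` or reject one of value `1`. -/
theorem symRungNU_of_foolingPairs (hS : SupportTheoremANF) (hF : ∀ k, FoolingPairs k) : SymRungNU := by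
  rw [symRungNU_iff]
  intro C hC hsol
  obtain ⟨k, n₀, hk⟩ := hS C hC
  obtain ⟨n, hn, he, F, G, F', G', hequiv, h1, h2⟩ := hF k n₀
  have ha : accepts C ⟨n, F, G⟩ = true := (hsol ⟨n, F, G⟩ he).1 h1
  have hb : accepts C ⟨n, F', G'⟩ = false := (hsol ⟨n, F', G'⟩ he).2 h2
  have hab : accepts C ⟨n, F, G⟩ = accepts C ⟨n, F', G'⟩ := hk n hn F G F' G' hequiv
  rw [ha, hb] at hab
  exact Bool.noConfusion hab


end Summit.QuantumAdvantage.QuantumAdvantage.Theorems.PebbleDial
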